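import Literature.AlgebraicGeometry.Deformation.MorphismLiftsSquareZeroObstruction
import Literature.AlgebraicGeometry.Deformation.DerivationsKilledByIdeal
import HarnessLib

/-!
# The difference of two local lifts on the overlap of two AFFINE OPENS of the source, read in a common affine target
# ([SGA1] III Prop. 5.1: «la différence de deux prolongements locaux», chart form on `Γ(Z, U₁ ∩ U₂)`)

Layer `Literature/AlgebraicGeometry/Deformation` (cell hodgecm-mathlib, (E) of [MFK94] Prop. 6.15, brick C4 §1 of
`B-provers/B-p01/g16/SOCKETS-A4b-FileA-E.v0`).  THEOREMS ONLY.  Sequel of ★ `MorphismLiftsSquareZeroObstruction` (O5):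
that file reads lifts through abstract affine charts `e α : Spec (B α) → Z`; the Čech class of the obstruction needs the
charts to be the AFFINE OPENS `U` of `Z` themselves (`B = Γ(Z, U)`, `e = fromSpec`), their pairwise intersections, and the
restriction maps of `𝒪_Z` between them.  This file is that specialisation for ONE PAIR `U₁, U₂`:

* §1 `surjective_specMap_of_surjective_of_ker_sq_eq_bot` — `Spec (π)` is surjective for a surjective ring map with
  square-zero kernel (the thickening sees every point);
* §2 for a square-zero thickening `i : Z₀ → Z` cartesian over `Spec (A ↠ A⧸J)` and an affine open `U ⊆ Z`:
  `i.app U` is surjective with kernel `J·Γ(Z, U)` (★ `ker_app_eq_map_of_isPullback`), its square is zero, and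
  `Spec (i.app U)` is surjective;
* §3 **the pair**: local `S`-lifts `g₁ : Spec Γ(Z, U₁) → X`, `g₂ : Spec Γ(Z, U₂) → X` of `f₀ : Z₀ → X` through affine opens
  `V₁`, `V₂`; their restrictions `gₖ' = Spec (res) ≫ gₖ` to `Spec Γ(Z, W)`, `W ⊆ U₁ ∩ U₂` affine (the pairwise or triple
  intersection), are `S`-lifts of `f₀` agreeing on `Spec Γ(Z₀, i⁻¹W)` (`restrict_comp_agree`) and each lands where the
  other does (`restrict_preimage_eq_top_of_right/left`); hence (★ O5 (ii) `existsUnique_derivation_of_lifts`) in any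
  common affine target `V'` the DIFFERENCE OF THEIR CHARTS `δ = ψ(g₂') − ψ(g₁') : Γ(X, V') → Γ(Z, W)` is Leibniz along
  `ψ(g₁')`, kills the scalars `A`, and takes values in `ker (i.app W) = J·Γ(Z, W)` (`difference_leibniz_and_mem_ker`).

Everything is stated in the BARE chart dialect of O5 (`ψ_V(g) = g.appLE V ⊤ ≫ ΓSpecIso`), with the charts passed as
variables `ψₖ` together with their defining equations, so that consumers substitute once.
HC_CM is proved only modulo the 7 printed citations until rung 0 closes; this file discharges none of them.

## References
* [SGA1] A. Grothendieck, M. Raynaud, *SGA 1*, LNM 224 / arXiv:math/0206203: Exp. III §5 Prop. 5.1 (arXiv ed. p. 71).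
* [MumfordFogartyKirwan1994] D. Mumford, J. Fogarty, F. Kirwan, *Geometric Invariant Theory*, 3rd ed. (1994), Ch. 6 §3
  Prop. 6.15 (pp. 124–125).
-/

noncomputable section

universe u

open CategoryTheory CategoryTheory.Limits AlgebraicGeometry Opposite

namespace Literature.AlgebraicGeometry.Deformation

/-! ### §1 `Spec` of a surjection with square-zero kernel is surjective -/

/-- **A square-zero thickening sees every point**: for a surjective ring map `π : B → B₀` with `(ker π)² = 0`, the closed
immersion `Spec B₀ → Spec B` is surjective (its image is `V(ker π) = V(0)`). [cite: SGA1, Exp. III §5 Prop. 5.1] -/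
theorem surjective_specMap_of_surjective_of_ker_sq_eq_bot {B B₀ : Type u} [CommRing B] [CommRing B₀] (π : B →+* B₀)
    (hπ : Function.Surjective π) (hπ2 : RingHom.ker π ^ 2 = ⊥) :
    Surjective (Spec.map (CommRingCat.ofHom π)) := by
  refine ⟨fun x => ?_⟩
  have hle : RingHom.ker π ≤ nilradical B := fun b hb =>
    ⟨2, by have h := Ideal.pow_mem_pow hb 2; rw [hπ2, Ideal.mem_bot] at h; exact h⟩
  have hx : x ∈ Set.range (PrimeSpectrum.comap π) := by
    rw [range_comap_of_surjective _ _ hπ, (PrimeSpectrum.zeroLocus_eq_univ_iff _).mpr hle]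
    trivial
  obtain ⟨y, hy⟩ := hx
  exact ⟨y, hy⟩

/-! ### §2 The thickening on an affine open: `(ker i♯_U)² = 0` and `Spec (i♯_U)` is surjective -/

section Thickening

variable {Z Z₀ : Scheme.{u}} {A : Type u} [CommRing A] (J : Ideal A) {q : Z ⟶ Spec (.of A)}
  {q₀ : Z₀ ⟶ Spec (.of (A ⧸ J))} {i : Z₀ ⟶ Z}
  (hi : IsPullback i q₀ q (Spec.map (CommRingCat.ofHom (Ideal.Quotient.mk J))))

include hi in
/-- If `J² = 0` then `(ker i♯_U)² = 0` on every affine open `U` (`ker i♯_U = J·Γ(Z, U)`, ★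
`app_surjective_and_ker_eq_of_isPullback_mk`). [cite: SGA1, Exp. III §5 Prop. 5.1] -/
theorem ker_app_sq_eq_bot_of_isPullback_mk (hJ2 : J * J = ⊥) (U : Z.affineOpens) :
    RingHom.ker (i.app U.1).hom ^ 2 = ⊥ := by
  rw [(app_surjective_and_ker_eq_of_isPullback_mk J hi U).2, ← Ideal.map_pow, pow_two, hJ2, Ideal.map_bot]

include hi in
/-- `Spec (i♯_U) : Spec Γ(Z₀, i⁻¹U) → Spec Γ(Z, U)` is surjective when `J² = 0`. [cite: SGA1, Exp. III §5 Prop. 5.1] -/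
theorem surjective_specMap_app_of_isPullback_mk (hJ2 : J * J = ⊥) (U : Z.affineOpens) :
    Surjective (Spec.map (i.app U.1)) := by
  have h := surjective_specMap_of_surjective_of_ker_sq_eq_bot (i.app U.1).hom
    (app_surjective_and_ker_eq_of_isPullback_mk J hi U).1 (ker_app_sq_eq_bot_of_isPullback_mk J hi hJ2 U)
  rwa [CommRingCat.ofHom_hom] at h

end Thickening

/-! ### §3 The pair: two local lifts restricted to an affine `W ⊆ U₁ ∩ U₂`, read in a common affine target `V'` -/

section Pair

variable {X Z Z₀ : Scheme.{u}} {A : Type u} [CommRing A] (J : Ideal A) (p : X ⟶ Spec (.of A))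
  (q : Z ⟶ Spec (.of A)) {q₀ : Z₀ ⟶ Spec (.of (A ⧸ J))} {i : Z₀ ⟶ Z}
  (hi : IsPullback i q₀ q (Spec.map (CommRingCat.ofHom (Ideal.Quotient.mk J))))
  (f₀ : Z₀ ⟶ X) {U₁ U₂ W : Z.Opens} (hU₁ : IsAffineOpen U₁) (hU₂ : IsAffineOpen U₂) (hW : IsAffineOpen W)
  (hW₁ : W ≤ U₁) (hW₂ : W ≤ U₂)
  {V₁ V₂ V' : X.Opens} (g₁ : Spec (.of Γ(Z, U₁)) ⟶ X) (g₂ : Spec (.of Γ(Z, U₂)) ⟶ X)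

/-- **Restricting a local lift keeps it over `S`**: if `g₁ ≫ p = fromSpec_{U₁} ≫ q` then
`(Spec (res) ≫ g₁) ≫ p = fromSpec_{W} ≫ q` for every affine `W ≤ U₁`. [cite: SGA1, Exp. III §5 Prop. 5.1] -/
theorem restrict_comp_over (w₁ : g₁ ≫ p = hU₁.fromSpec ≫ q) :
    (Spec.map (Z.presheaf.map (homOfLE hW₁).op) ≫ g₁) ≫ p = hW.fromSpec ≫ q := by
  rw [Category.assoc, w₁, ← Category.assoc, IsAffineOpen.map_fromSpec hU₁ hW]

include hi in
/-- **Restricting a local lift keeps it a lift of `f₀`**: if `Spec (i♯_{U₁}) ≫ g₁ = fromSpec_{i⁻¹U₁} ≫ f₀` then the same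
holds on every affine `W ≤ U₁` (naturality of `i♯` and of `fromSpec`). [cite: SGA1, Exp. III §5 Prop. 5.1] -/
theorem restrict_comp_reduction
    (h₁ : Spec.map (i.app U₁) ≫ g₁ = (isAffineOpen_preimage_of_isPullback_mk J hi ⟨U₁, hU₁⟩).fromSpec ≫ f₀) :
    Spec.map (i.app W) ≫ (Spec.map (Z.presheaf.map (homOfLE hW₁).op) ≫ g₁) =
      (isAffineOpen_preimage_of_isPullback_mk J hi ⟨W, hW⟩).fromSpec ≫ f₀ := by
  have hnat : Z.presheaf.map (homOfLE hW₁).op ≫ i.app W =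
      i.app U₁ ≫ Z₀.presheaf.map (homOfLE (i.preimage_mono hW₁)).op := i.naturality (homOfLE hW₁).op
  rw [← Category.assoc, ← Spec.map_comp, hnat, Spec.map_comp, Category.assoc, h₁, ← Category.assoc,
    IsAffineOpen.map_fromSpec _ (isAffineOpen_preimage_of_isPullback_mk J hi ⟨W, hW⟩)]

include hi hW in
/-- **The two restricted lifts agree on the thickened `W`**: `Spec (i♯_W) ≫ g₁' = Spec (i♯_W) ≫ g₂'` for
`gₖ' = Spec (res) ≫ gₖ`, both being `fromSpec_{i⁻¹W} ≫ f₀`. [cite: SGA1, Exp. III §5 Prop. 5.1] -/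
theorem restrict_comp_agree
    (h₁ : Spec.map (i.app U₁) ≫ g₁ = (isAffineOpen_preimage_of_isPullback_mk J hi ⟨U₁, hU₁⟩).fromSpec ≫ f₀)
    (h₂ : Spec.map (i.app U₂) ≫ g₂ = (isAffineOpen_preimage_of_isPullback_mk J hi ⟨U₂, hU₂⟩).fromSpec ≫ f₀) :
    Spec.map (i.app W) ≫ (Spec.map (Z.presheaf.map (homOfLE hW₁).op) ≫ g₁) =
      Spec.map (i.app W) ≫ (Spec.map (Z.presheaf.map (homOfLE hW₂).op) ≫ g₂) := by
  rw [restrict_comp_reduction J q hi f₀ hU₁ hW hW₁ g₁ h₁, restrict_comp_reduction J q hi f₀ hU₂ hW hW₂ g₂ h₂]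

/-- A restricted lift lands where the lift lands: `(Spec (res) ≫ g₁)⁻¹ V₁ = ⊤`. [cite: SGA1, Exp. III §5 Prop. 5.1] -/
theorem restrict_preimage_eq_top (hg₁ : g₁ ⁻¹ᵁ V₁ = ⊤) :
    (Spec.map (Z.presheaf.map (homOfLE hW₁).op) ≫ g₁) ⁻¹ᵁ V₁ = ⊤ := by
  rw [Scheme.Hom.comp_preimage, hg₁]
  rfl

include hi hW hW₂ in
/-- **The first restricted lift lands where the SECOND lift lands** (`J² = 0`): `g₁'` and `g₂'` agree after the surjective
`Spec (i♯_W)`, hence have the same underlying map (★ `preimage_eq_of_comp_eq`). [cite: SGA1, Exp. III §5 Prop. 5.1] -/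
theorem restrict_preimage_eq_top_of_right (hJ2 : J * J = ⊥) (hg₂ : g₂ ⁻¹ᵁ V₂ = ⊤)
    (h₁ : Spec.map (i.app U₁) ≫ g₁ = (isAffineOpen_preimage_of_isPullback_mk J hi ⟨U₁, hU₁⟩).fromSpec ≫ f₀)
    (h₂ : Spec.map (i.app U₂) ≫ g₂ = (isAffineOpen_preimage_of_isPullback_mk J hi ⟨U₂, hU₂⟩).fromSpec ≫ f₀) :
    (Spec.map (Z.presheaf.map (homOfLE hW₁).op) ≫ g₁) ⁻¹ᵁ V₂ = ⊤ := by
  haveI := surjective_specMap_app_of_isPullback_mk J hi hJ2 ⟨W, hW⟩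
  rw [preimage_eq_of_comp_eq _ (restrict_comp_agree J q hi f₀ hU₁ hU₂ hW hW₁ hW₂ g₁ g₂ h₁ h₂) V₂]
  exact restrict_preimage_eq_top hW₂ g₂ hg₂

include hi hW hW₁ in
/-- Symmetrically, the second restricted lift lands where the first lift lands. [cite: SGA1, Exp. III §5 Prop. 5.1] -/
theorem restrict_preimage_eq_top_of_left (hJ2 : J * J = ⊥) (hg₁ : g₁ ⁻¹ᵁ V₁ = ⊤)
    (h₁ : Spec.map (i.app U₁) ≫ g₁ = (isAffineOpen_preimage_of_isPullback_mk J hi ⟨U₁, hU₁⟩).fromSpec ≫ f₀)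
    (h₂ : Spec.map (i.app U₂) ≫ g₂ = (isAffineOpen_preimage_of_isPullback_mk J hi ⟨U₂, hU₂⟩).fromSpec ≫ f₀) :
    (Spec.map (Z.presheaf.map (homOfLE hW₂).op) ≫ g₂) ⁻¹ᵁ V₁ = ⊤ := by
  haveI := surjective_specMap_app_of_isPullback_mk J hi hJ2 ⟨W, hW⟩
  rw [← preimage_eq_of_comp_eq _ (restrict_comp_agree J q hi f₀ hU₁ hU₂ hW hW₁ hW₂ g₁ g₂ h₁ h₂) V₁]
  exact restrict_preimage_eq_top hW₁ g₁ hg₁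

include hi hW in
/-- **The difference of the two charts is a derivation with values in `J·Γ(Z, W)`** ([SGA1] III Prop. 5.1: «la
différence de deux prolongements locaux est une section de `𝒢 = 𝓗om(g₀^*Ω¹_{X/S}, 𝒥)`», read on an affine `W ⊆ U₁ ∩ U₂`
with a common affine target `V'` containing the images).  DATA: the square-zero thickening `i : Z₀ → Z` cartesian over
`Spec (A ↠ A⧸J)`, `J² = 0`; `f₀ : Z₀ → X`; local `S`-lifts `gₖ : Spec Γ(Z, Uₖ) → X` of `f₀` (`k = 1, 2`); an affine
`W ≤ U₁, U₂` and an affine `V' ⊆ X` in which both restricted lifts `gₖ' = Spec (res) ≫ gₖ` land; the charts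
`ψₖ = ψ_{V'}(gₖ') : Γ(X, V') → Γ(Z, W)` passed as variables with their defining equations.  CONCLUSION: `δ = ψ₂ − ψ₁` is
Leibniz along `ψ₁` (`δ(ab) = ψ₁(a) δ(b) + ψ₁(b) δ(a)`), both charts intertwine the scalar maps
`s_{V'} = ΓSpecIso⁻¹ ≫ p.appLE ⊤ V'` and `s_W = ΓSpecIso⁻¹ ≫ q.appLE ⊤ W` (so `δ` kills the scalars), and
`δ(a) ∈ ker (i♯_W) = J·Γ(Z, W)`.  Proof: ★ O5 (ii)
`existsUnique_derivation_of_lifts`. [cite: SGA1, Exp. III §5 Prop. 5.1]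
[cite: MumfordFogartyKirwan1994, Ch. 6 §3 Prop. 6.15 (pp. 124–125)] -/
theorem difference_leibniz_and_mem_ker (hJ2 : J * J = ⊥) (hV' : IsAffineOpen V')
    (w₁ : g₁ ≫ p = hU₁.fromSpec ≫ q) (w₂ : g₂ ≫ p = hU₂.fromSpec ≫ q)
    (h₁ : Spec.map (i.app U₁) ≫ g₁ = (isAffineOpen_preimage_of_isPullback_mk J hi ⟨U₁, hU₁⟩).fromSpec ≫ f₀)
    (h₂ : Spec.map (i.app U₂) ≫ g₂ = (isAffineOpen_preimage_of_isPullback_mk J hi ⟨U₂, hU₂⟩).fromSpec ≫ f₀)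
    (h₁' : (Spec.map (Z.presheaf.map (homOfLE hW₁).op) ≫ g₁) ⁻¹ᵁ V' = ⊤)
    (h₂' : (Spec.map (Z.presheaf.map (homOfLE hW₂).op) ≫ g₂) ⁻¹ᵁ V' = ⊤)
    (ψ₁ ψ₂ : Γ(X, V') ⟶ CommRingCat.of Γ(Z, W))
    (hψ₁ : ψ₁ = (Spec.map (Z.presheaf.map (homOfLE hW₁).op) ≫ g₁).appLE V' ⊤ h₁'.ge ≫
      (Scheme.ΓSpecIso (.of Γ(Z, W))).hom)
    (hψ₂ : ψ₂ = (Spec.map (Z.presheaf.map (homOfLE hW₂).op) ≫ g₂).appLE V' ⊤ h₂'.ge ≫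
      (Scheme.ΓSpecIso (.of Γ(Z, W))).hom) :
    (∀ a b, ψ₂ (a * b) - ψ₁ (a * b) = ψ₁ a * (ψ₂ b - ψ₁ b) + ψ₁ b * (ψ₂ a - ψ₁ a)) ∧
    (∀ x : A, ψ₁ (((Scheme.ΓSpecIso (.of A)).inv ≫ p.appLE ⊤ V' le_top) x) =
        ((Scheme.ΓSpecIso (.of A)).inv ≫ q.appLE ⊤ W le_top) x) ∧
    (∀ x : A, ψ₂ (((Scheme.ΓSpecIso (.of A)).inv ≫ p.appLE ⊤ V' le_top) x) =
        ((Scheme.ΓSpecIso (.of A)).inv ≫ q.appLE ⊤ W le_top) x) ∧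
    (∀ a, ψ₂ a - ψ₁ a ∈ RingHom.ker (i.app W).hom) := by
  -- the scalar structure on `Γ(Z, W)` and the two restricted lifts as `S`-morphisms in O5's form
  set sB : CommRingCat.of A ⟶ Γ(Z, W) := (Scheme.ΓSpecIso (.of A)).inv ≫ q.appLE ⊤ W le_top with hsB
  letI : Algebra A Γ(Z, W) := sB.hom.toAlgebra
  have halg : CommRingCat.ofHom (algebraMap A Γ(Z, W)) = sB := rfl
  set g₁' := Spec.map (Z.presheaf.map (homOfLE hW₁).op) ≫ g₁ with hg₁'
  set g₂' := Spec.map (Z.presheaf.map (homOfLE hW₂).op) ≫ g₂ with hg₂'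
  have w₁' : g₁' ≫ p = Spec.map (CommRingCat.ofHom (algebraMap A Γ(Z, W))) := by
    rw [halg, hsB, ← fromSpec_comp_eq_specMap hW q]
    exact restrict_comp_over p q hU₁ hW hW₁ g₁ w₁
  have w₂' : g₂' ≫ p = Spec.map (CommRingCat.ofHom (algebraMap A Γ(Z, W))) := by
    rw [halg, hsB, ← fromSpec_comp_eq_specMap hW q]
    exact restrict_comp_over p q hU₂ hW hW₂ g₂ w₂
  have hagree : Spec.map (CommRingCat.ofHom (i.app W).hom) ≫ g₁' = Spec.map (CommRingCat.ofHom (i.app W).hom) ≫ g₂' := by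
    rw [CommRingCat.ofHom_hom]
    exact restrict_comp_agree J q hi f₀ hU₁ hU₂ hW hW₁ hW₂ g₁ g₂ h₁ h₂
  have hπ2 := ker_app_sq_eq_bot_of_isPullback_mk J hi hJ2 ⟨W, hW⟩
  letI algV : Algebra A Γ(X, V') := ((Scheme.ΓSpecIso (.of A)).inv ≫ p.appLE ⊤ V' le_top).hom.toAlgebra
  letI algVB : Algebra Γ(X, V') Γ(Z, W) := (g₁'.appLE V' ⊤ h₁'.ge ≫ (Scheme.ΓSpecIso (.of Γ(Z, W))).hom).hom.toAlgebra
  obtain ⟨δ, hδ, -⟩ := existsUnique_derivation_of_lifts p (i.app W).hom hV' hπ2 g₁' g₂' w₁' w₂' hagree h₁' h₂'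
  -- `ψ₂ − ψ₁ = δ` pointwise
  subst hψ₁ hψ₂
  have hd : ∀ a, (g₂'.appLE V' ⊤ h₂'.ge ≫ (Scheme.ΓSpecIso (.of Γ(Z, W))).hom) a -
      (g₁'.appLE V' ⊤ h₁'.ge ≫ (Scheme.ΓSpecIso (.of Γ(Z, W))).hom) a = (δ a : Γ(Z, W)) := by
    intro a
    rw [sub_eq_iff_eq_add']
    exact hδ a
  -- the charts are `A`-algebra maps (★ `comp_eq_specMap_algebraMap_iff`)
  have hc₁ : ((Scheme.ΓSpecIso (.of A)).inv ≫ p.appLE ⊤ V' le_top) ≫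
      (g₁'.appLE V' ⊤ h₁'.ge ≫ (Scheme.ΓSpecIso (.of Γ(Z, W))).hom) = CommRingCat.ofHom (algebraMap A Γ(Z, W)) :=
    (comp_eq_specMap_algebraMap_iff hV' p _).mp ((eq_specMap_appLE_comp_fromSpec hV' g₁' h₁') ▸ w₁')
  have hc₂ : ((Scheme.ΓSpecIso (.of A)).inv ≫ p.appLE ⊤ V' le_top) ≫
      (g₂'.appLE V' ⊤ h₂'.ge ≫ (Scheme.ΓSpecIso (.of Γ(Z, W))).hom) = CommRingCat.ofHom (algebraMap A Γ(Z, W)) :=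
    (comp_eq_specMap_algebraMap_iff hV' p _).mp ((eq_specMap_appLE_comp_fromSpec hV' g₂' h₂') ▸ w₂')
  refine ⟨fun a b => ?_, fun x => ?_, fun x => ?_, fun a => ?_⟩
  · rw [hd, hd, hd, δ.leibniz]
    rfl
  · exact (congrArg (fun φ => φ.hom x) hc₁).trans rfl
  · exact (congrArg (fun φ => φ.hom x) hc₂).trans rfl
  · rw [hd]
    exact (δ a).2

end Pair

/-! ### §4 Charts of restricted morphisms; landing in intersections -/

section Charts

variable {X : Scheme.{u}} {V' V'' : X.Opens} (hV' : IsAffineOpen V') (l : V'' ≤ V') {B C : CommRingCat.{u}}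

include hV' in
/-- **The chart of a pulled-back morphism is the chart followed by the pull-back map**: for `t : Spec B → X` landing
in the affine `V'` and a ring map `u : B → C`, `ψ_{V'}(Spec u ≫ t) = ψ_{V'}(t) ≫ u` (★ O5 `chart_specMap_comp`, here for a
plain ring map). [cite: SGA1, Exp. III §5 Prop. 5.1] -/
theorem chart_specMap_comp_hom (t : Spec B ⟶ X) (ht : t ⁻¹ᵁ V' = ⊤) (u : B ⟶ C) (ht' : (Spec.map u ≫ t) ⁻¹ᵁ V' = ⊤) :
    (Spec.map u ≫ t).appLE V' ⊤ ht'.ge ≫ (Scheme.ΓSpecIso C).hom = (t.appLE V' ⊤ ht.ge ≫ (Scheme.ΓSpecIso B).hom) ≫ u := by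
  refine appLE_comp_ΓSpecIso_of_eq hV' _ _ ht' ?_
  conv_lhs => rw [eq_specMap_appLE_comp_fromSpec hV' t ht]
  simp only [Spec.map_comp, Category.assoc]

include hV' in
/-- **Restricting source and target**: for `t : Spec B → X` landing in the affine `V'`, `u : B → C`, and `V″ ≤ V'` in
which `Spec u ≫ t` lands: `ψ_{V″}(Spec u ≫ t)(a|_{V″}) = u(ψ_{V'}(t)(a))` (★ `chart_map_apply` + `chart_specMap_comp_hom`).
[cite: SGA1, Exp. III §5 Prop. 5.1] -/
theorem chart_restrict_apply (t : Spec B ⟶ X) (ht : t ⁻¹ᵁ V' = ⊤) (u : B ⟶ C) (ht'' : (Spec.map u ≫ t) ⁻¹ᵁ V'' = ⊤)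
    (a : Γ(X, V')) :
    ((Spec.map u ≫ t).appLE V'' ⊤ ht''.ge ≫ (Scheme.ΓSpecIso C).hom) (X.presheaf.map (homOfLE l).op a) =
      u ((t.appLE V' ⊤ ht.ge ≫ (Scheme.ΓSpecIso B).hom) a) := by
  have ht' : (Spec.map u ≫ t) ⁻¹ᵁ V' = ⊤ := by rw [Scheme.Hom.comp_preimage, ht]; rfl
  have h1 := chart_map_apply l (Spec.map u ≫ t) ht' ht'' a
  rw [chart_specMap_comp_hom hV' t ht u ht'] at h1
  exact h1

end Charts

section Landing

variable {X Z Z₀ : Scheme.{u}} {A : Type u} [CommRing A] (J : Ideal A)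
  (q : Z ⟶ Spec (.of A)) {q₀ : Z₀ ⟶ Spec (.of (A ⧸ J))} {i : Z₀ ⟶ Z}
  (hi : IsPullback i q₀ q (Spec.map (CommRingCat.ofHom (Ideal.Quotient.mk J))))
  (f₀ : Z₀ ⟶ X) {U₁ U₂ W : Z.Opens} (hU₁ : IsAffineOpen U₁) (hU₂ : IsAffineOpen U₂) (hW : IsAffineOpen W)
  (hW₁ : W ≤ U₁) (hW₂ : W ≤ U₂)
  {V₁ V₂ : X.Opens} (g₁ : Spec (.of Γ(Z, U₁)) ⟶ X) (g₂ : Spec (.of Γ(Z, U₂)) ⟶ X)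

include hi hW hW₂ in
/-- The first restricted lift lands in `V₁ ∩ V₂`. [cite: SGA1, Exp. III §5 Prop. 5.1] -/
theorem restrict_preimage_inf_eq_top_left (hJ2 : J * J = ⊥) (hg₁ : g₁ ⁻¹ᵁ V₁ = ⊤) (hg₂ : g₂ ⁻¹ᵁ V₂ = ⊤)
    (h₁ : Spec.map (i.app U₁) ≫ g₁ = (isAffineOpen_preimage_of_isPullback_mk J hi ⟨U₁, hU₁⟩).fromSpec ≫ f₀)
    (h₂ : Spec.map (i.app U₂) ≫ g₂ = (isAffineOpen_preimage_of_isPullback_mk J hi ⟨U₂, hU₂⟩).fromSpec ≫ f₀) :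
    (Spec.map (Z.presheaf.map (homOfLE hW₁).op) ≫ g₁) ⁻¹ᵁ (V₁ ⊓ V₂) = ⊤ := by
  rw [Scheme.Hom.preimage_inf, restrict_preimage_eq_top hW₁ g₁ hg₁,
    restrict_preimage_eq_top_of_right J q hi f₀ hU₁ hU₂ hW hW₁ hW₂ g₁ g₂ hJ2 hg₂ h₁ h₂, top_inf_eq]

include hi hW hW₁ in
/-- The second restricted lift lands in `V₁ ∩ V₂`. [cite: SGA1, Exp. III §5 Prop. 5.1] -/
theorem restrict_preimage_inf_eq_top_right (hJ2 : J * J = ⊥) (hg₁ : g₁ ⁻¹ᵁ V₁ = ⊤) (hg₂ : g₂ ⁻¹ᵁ V₂ = ⊤)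
    (h₁ : Spec.map (i.app U₁) ≫ g₁ = (isAffineOpen_preimage_of_isPullback_mk J hi ⟨U₁, hU₁⟩).fromSpec ≫ f₀)
    (h₂ : Spec.map (i.app U₂) ≫ g₂ = (isAffineOpen_preimage_of_isPullback_mk J hi ⟨U₂, hU₂⟩).fromSpec ≫ f₀) :
    (Spec.map (Z.presheaf.map (homOfLE hW₂).op) ≫ g₂) ⁻¹ᵁ (V₁ ⊓ V₂) = ⊤ := by
  rw [Scheme.Hom.preimage_inf, restrict_preimage_eq_top hW₂ g₂ hg₂,
    restrict_preimage_eq_top_of_left J q hi f₀ hU₁ hU₂ hW hW₁ hW₂ g₁ g₂ hJ2 hg₁ h₁ h₂, inf_top_eq]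

end Landing

end Literature.AlgebraicGeometry.Deformation

end
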